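import Summits.CriticalPhenomena.PercolationContinuityZ3.Theorems.PercNearOneGluingNoHeavyLowerTailAntitheticUConeConsistency
import HarnessLib

/-!
# `NoHeavyLowerTail` (stmt-CriticalPhenomena-4575) — antithetic cluster pairs: the zone system of THEOREM U — part 3: invariance of
# STANDARD zones, the LAST-EXIT path lemma, and NO SWALLOWING for a red-reached vertex (prim-hp-2 gen 37; HOME/THEOREM-U-universal.md)

Support file (`--supports stmt-CriticalPhenomena-4575`, hull-port prover `prim-hp-2`, gen 37).  No definitions, no named facts, no sorries;
standard axioms.  Setting and rule: `…AntitheticUConeZones`.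

For `T, M` in the constraint set with `M` agreeing with `T` (or `Tᶜ`) on zone blocks of `T`:
* `UCone.std_basic` — for `q` red-reached in `T` and `M = T` on its block: the blue cluster of `q` is unchanged, `q` is not blue-reached in `M`,
  and if `q` is red-reached in `M` its zone is unchanged (cluster congruence; no class hypothesis).
* `UCone.reached_of_hubv_mem` — the path lemma (iv-a): if moreover the universal vertex `k₀` lies in the zone of `q`, then `q` IS red-reached in
  `M` (every vertex outside the zone is joined to `k₀` by a red edge of the block, and `s k₀` is red; walk induction `reach_along`).
* `UCone.std_inv` — the four colour/agreement variants, by the swaps `(T,M) ↦ (Tᶜ,Mᶜ), (T,Mᶜ)`.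
* `UCone.not_sw_red` — (iv-b): a red-reached `r` with `k₀` outside its zone that becomes unreached in `M` is not swallowed in `M`.
[cite: VandenbergHaggstromKahn2005, §1 p. 3 (open cluster `C_s`)]
-/

noncomputable section

namespace Summit.CriticalPhenomena.PercolationContinuityZ3.Theorems

open Literature.Probability.Percolation
open scoped Classical symmDiff

namespace Antithetic

section ClusterTools

variable {V : Type*}

/-- Reachability pushed along a walk: if every step of an `ω`-walk preserves `ω'`-reachability from `s`, the endpoint is `ω'`-reachable.
[folklore] -/
theorem reach_along (ω ω' : BondConfig V) (s : V)
    (hstep : ∀ x y, s(x, y) ∈ ω → x ≠ y → (openGraph ω').Reachable s x → (openGraph ω').Reachable s y) :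
    ∀ {x q : V} (_ : (openGraph ω).Walk x q), (openGraph ω').Reachable s x → (openGraph ω').Reachable s q := by
  intro x q p
  induction p with
  | nil => exact id
  | @cons a b c hab _ ih =>
    intro ha
    rw [openGraph_adj] at hab
    exact ih (hstep a b hab.1 hab.2 ha)

end ClusterTools

namespace UCone

section Invariance

variable {V : Type*} {E : Set (Sym2 V)} {s k₀ : V} {R : Set V} {T M : Set (Sym2 V)}

/-- **Standard-zone basics** (`q` red-reached in `T`, `M = T` on the block of its zone): the blue cluster of `q` is the same in `M`; `q` is
not blue-reached in `M`; if `q` is red-reached in `M` its zone is unchanged. [this work] -/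
theorem std_basic {q : V} (hDT : ¬ ((openGraph (T ∩ E)).Reachable s q ∧ (openGraph (Tᶜ ∩ E)).Reachable s q))
    (hDM : ¬ ((openGraph (M ∩ E)).Reachable s q ∧ (openGraph (Mᶜ ∩ E)).Reachable s q))
    (hq : (openGraph (T ∩ E)).Reachable s q) (hag : ∀ e ∈ ZoneSys.blk E (zone E s k₀ R T q), (e ∈ M ↔ e ∈ T)) :
    openCluster (Mᶜ ∩ E) q = openCluster (Tᶜ ∩ E) q ∧ ¬ (openGraph (Mᶜ ∩ E)).Reachable s q ∧
      ((openGraph (M ∩ E)).Reachable s q → zone E s k₀ R M q = zone E s k₀ R T q) := by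
  have hZ := zone_of_red (k₀ := k₀) (R := R) hDT hq
  have hcl : openCluster (Mᶜ ∩ E) q = openCluster (Tᶜ ∩ E) q := by
    refine openCluster_eq_of_agree' (Tᶜ ∩ E) (Mᶜ ∩ E) q fun x hx y hxy => ?_
    by_cases hE : s(x, y) ∈ E
    · have hb : s(x, y) ∈ ZoneSys.blk E (zone E s k₀ R T q) := by
        rw [hZ]; exact ZoneSys.mk_mem_blk hE hxy (Or.inl hx)
      have := hag _ hb
      simp only [Set.mem_inter_iff, Set.mem_compl_iff, hE, and_true, this]
    · simp only [Set.mem_inter_iff, hE, and_false]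
  have hnb : ¬ (openGraph (Mᶜ ∩ E)).Reachable s q := fun h => by
    have hs : s ∈ openCluster (Mᶜ ∩ E) q := h.symm
    rw [hcl] at hs
    exact hDT ⟨hq, (show (openGraph (Tᶜ ∩ E)).Reachable q s from hs).symm⟩
  exact ⟨hcl, hnb, fun hr => by rw [zone_of_red hDM hr, hcl, hZ]⟩

/-- **Path lemma (iv-a)**: `q` red-reached in `T`, `M = T` on the block of its zone, and the universal vertex `k₀` inside the zone ⇒ `q` is
red-reached in `M`. [this work] -/
theorem reached_of_hubv_mem (hk : k₀ ≠ s) (huniv : ∀ v, v ≠ k₀ → s(k₀, v) ∈ E) {q : V}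
    (hDT : ¬ ((openGraph (T ∩ E)).Reachable s q ∧ (openGraph (Tᶜ ∩ E)).Reachable s q))
    (hq : (openGraph (T ∩ E)).Reachable s q) (hag : ∀ e ∈ ZoneSys.blk E (zone E s k₀ R T q), (e ∈ M ↔ e ∈ T))
    (hk₀ : k₀ ∈ zone E s k₀ R T q) : (openGraph (M ∩ E)).Reachable s q := by
  have hZ := zone_of_red (k₀ := k₀) (R := R) hDT hq
  set C := openCluster (Tᶜ ∩ E) q with hC
  rw [hZ] at hag hk₀
  have hnb : ¬ (openGraph (Tᶜ ∩ E)).Reachable s q := fun h => hDT ⟨hq, h⟩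
  have hsC : s ∉ C := fun h => hnb (show (openGraph (Tᶜ ∩ E)).Reachable q s from h).symm
  -- `s k₀` is red in `T` and in `M`
  have hsk : s(s, k₀) ∈ E := by rw [Sym2.eq_swap]; exact huniv s hk.symm
  have hskT : s(s, k₀) ∈ T := by
    by_contra h
    exact not_reachable_of_mem_openCluster _ hk₀ hnb ((openGraph_adj (Tᶜ ∩ E) s k₀).2 ⟨⟨h, hsk⟩, hk.symm⟩).reachable
  have hskM : s(s, k₀) ∈ M := (hag _ (ZoneSys.mk_mem_blk hsk hk.symm (Or.inr hk₀))).2 hskT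
  have hk₀M : (openGraph (M ∩ E)).Reachable s k₀ := ((openGraph_adj (M ∩ E) s k₀).2 ⟨⟨hskM, hsk⟩, hk.symm⟩).reachable
  -- every vertex outside `C` is red-reached in `M` (through `k₀`)
  have hout : ∀ x, x ∉ C → (openGraph (M ∩ E)).Reachable s x := by
    intro x hxC
    have hxk : x ≠ k₀ := fun h => hxC (h ▸ hk₀)
    have hE : s(k₀, x) ∈ E := huniv x hxk
    have hT : s(k₀, x) ∈ T := by
      by_contra h
      exact hxC ((show (openGraph (Tᶜ ∩ E)).Reachable q k₀ from hk₀).trans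
        ((openGraph_adj (Tᶜ ∩ E) k₀ x).2 ⟨⟨h, hE⟩, hxk.symm⟩).reachable)
    have hM : s(k₀, x) ∈ M := (hag _ (ZoneSys.mk_mem_blk hE hxk.symm (Or.inl hk₀))).2 hT
    exact hk₀M.trans ((openGraph_adj (M ∩ E) k₀ x).2 ⟨⟨hM, hE⟩, hxk.symm⟩).reachable
  -- push reachability along a red `T`-walk from `s` to `q`
  obtain ⟨p⟩ := hq
  refine reach_along (T ∩ E) (M ∩ E) s (fun x y hxy hne hx => ?_) p (SimpleGraph.Reachable.refl s)
  by_cases hyC : y ∈ C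
  · have hM : s(x, y) ∈ M := (hag _ (ZoneSys.mk_mem_blk hxy.2 hne (Or.inr hyC))).2 hxy.1
    exact hx.trans ((openGraph_adj (M ∩ E) x y).2 ⟨⟨hM, hxy.2⟩, hne⟩).reachable
  · exact hout y hyC

/-- **Standard-zone invariance for THEOREM U** (four variants): for `q` reached in `T` and `M` agreeing with `T` or `Tᶜ` on the block of its
zone: if `q` is reached in `M` its zone is unchanged, and `q` IS reached in `M` whenever `k₀` lies in its zone. [this work] -/
theorem std_inv (hk : k₀ ≠ s) (huniv : ∀ v, v ≠ k₀ → s(k₀, v) ∈ E) {q : V}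
    (hDT : ¬ ((openGraph (T ∩ E)).Reachable s q ∧ (openGraph (Tᶜ ∩ E)).Reachable s q))
    (hDM : ¬ ((openGraph (M ∩ E)).Reachable s q ∧ (openGraph (Mᶜ ∩ E)).Reachable s q))
    (hq : (openGraph (T ∩ E)).Reachable s q ∨ (openGraph (Tᶜ ∩ E)).Reachable s q)
    (hag : (∀ e ∈ ZoneSys.blk E (zone E s k₀ R T q), (e ∈ M ↔ e ∈ T)) ∨
      (∀ e ∈ ZoneSys.blk E (zone E s k₀ R T q), (e ∈ M ↔ e ∉ T))) :
    (((openGraph (M ∩ E)).Reachable s q ∨ (openGraph (Mᶜ ∩ E)).Reachable s q) → zone E s k₀ R M q = zone E s k₀ R T q) ∧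
      (k₀ ∈ zone E s k₀ R T q → (openGraph (M ∩ E)).Reachable s q ∨ (openGraph (Mᶜ ∩ E)).Reachable s q) := by
  have hDT' : ¬ ((openGraph (Tᶜ ∩ E)).Reachable s q ∧ (openGraph (Tᶜᶜ ∩ E)).Reachable s q) := by
    rw [compl_compl]; exact fun h => hDT ⟨h.2, h.1⟩
  have hDM' : ¬ ((openGraph (Mᶜ ∩ E)).Reachable s q ∧ (openGraph (Mᶜᶜ ∩ E)).Reachable s q) := by
    rw [compl_compl]; exact fun h => hDM ⟨h.2, h.1⟩
  rcases hq with hq | hq <;> rcases hag with hag | hag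
  · obtain ⟨-, hnb, hz⟩ := std_basic (k₀ := k₀) (R := R) hDT hDM hq hag
    exact ⟨fun h => hz (h.resolve_right hnb), fun h => Or.inl (reached_of_hubv_mem hk huniv hDT hq hag h)⟩
  · obtain ⟨-, hnb, hz⟩ := std_basic (k₀ := k₀) (R := R) (M := Mᶜ) hDT hDM' hq (ACone.agree_compl_left hag)
    rw [compl_compl] at hnb
    rw [zone_compl] at hz
    exact ⟨fun h => hz (h.resolve_left hnb), fun h => Or.inr (reached_of_hubv_mem (M := Mᶜ) hk huniv hDT hq (ACone.agree_compl_left hag) h)⟩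
  · have hag' : ∀ e ∈ ZoneSys.blk E (zone E s k₀ R Tᶜ q), (e ∈ Mᶜ ↔ e ∈ Tᶜ) := by
      rw [zone_compl]; exact ACone.agree_compl_both hag
    obtain ⟨-, hnb, hz⟩ := std_basic (k₀ := k₀) (R := R) (T := Tᶜ) (M := Mᶜ) hDT' hDM' hq hag'
    rw [compl_compl] at hnb
    rw [zone_compl, zone_compl] at hz
    refine ⟨fun h => hz (h.resolve_left hnb), fun h => Or.inr ?_⟩
    exact reached_of_hubv_mem (T := Tᶜ) (M := Mᶜ) hk huniv hDT' hq hag' (by rw [zone_compl]; exact h)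
  · have hag' : ∀ e ∈ ZoneSys.blk E (zone E s k₀ R Tᶜ q), (e ∈ M ↔ e ∈ Tᶜ) := by
      rw [zone_compl]; exact fun e he => by rw [Set.mem_compl_iff]; exact hag e he
    obtain ⟨-, hnb, hz⟩ := std_basic (k₀ := k₀) (R := R) (T := Tᶜ) (M := M) hDT' hDM hq hag'
    rw [zone_compl] at hz
    exact ⟨fun h => hz (h.resolve_right hnb), fun h => Or.inl (reached_of_hubv_mem (T := Tᶜ) hk huniv hDT' hq hag' (by rw [zone_compl]; exact h))⟩

/-- The zone of a swallowed unreached vertex is the (standard) zone of a reached swallower, which contains `k₀`. [this work] -/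
theorem exists_swallower (hk : k₀ ≠ s) (huniv : ∀ v, v ≠ k₀ → s(k₀, v) ∈ E)
    (hT : ∀ r ∈ R, ¬ ((openGraph (T ∩ E)).Reachable s r ∧ (openGraph (Tᶜ ∩ E)).Reachable s r))
    {r : V} (hr : ¬ (openGraph (T ∩ E)).Reachable s r) (hb : ¬ (openGraph (Tᶜ ∩ E)).Reachable s r) (hsw : T ∈ swSet E s k₀ R) :
    ∃ q₁ ∈ R, ((openGraph (T ∩ E)).Reachable s q₁ ∨ (openGraph (Tᶜ ∩ E)).Reachable s q₁) ∧
      zone E s k₀ R T q₁ = hub E s k₀ T ∧ k₀ ∈ zone E s k₀ R T q₁ := by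
  obtain ⟨q, hqR, hq, hqh⟩ := hsw
  obtain ⟨hn1, hn2⟩ := hub_not_reached hk huniv hr hb
  refine ⟨q, hqR, hq, ?_⟩
  by_cases hsT : s(s, k₀) ∈ T
  · rw [hub_of_red hsT] at hqh ⊢
    have hqnb : ¬ (openGraph (Tᶜ ∩ E)).Reachable s q := not_reachable_of_mem_openCluster _ hqh (hn1 hsT)
    have hz : zone E s k₀ R T q = openCluster (Tᶜ ∩ E) k₀ := by
      rw [zone_of_red (hT q hqR) (hq.resolve_right hqnb), openCluster_eq_of_mem _ hqh]
    exact ⟨hz, hz ▸ mem_openCluster_self _ _⟩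
  · rw [hub_of_blue hsT] at hqh ⊢
    have hqnr : ¬ (openGraph (T ∩ E)).Reachable s q := not_reachable_of_mem_openCluster _ hqh (hn2 hsT)
    have hz : zone E s k₀ R T q = openCluster (T ∩ E) k₀ := by
      rw [zone_of_blue (hT q hqR) (hq.resolve_left hqnr), openCluster_eq_of_mem _ hqh]
    exact ⟨hz, hz ▸ mem_openCluster_self _ _⟩

/-- **No swallowing for a red-reached vertex (iv-b)**: `r` red-reached in `T` with `k₀` outside its zone, `M = T` on its block, `r`
unreached in `M`; then `M` is not swallowing. [this work] -/
theorem not_sw_red (hk : k₀ ≠ s) (huniv : ∀ v, v ≠ k₀ → s(k₀, v) ∈ E)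
    (hT : ∀ r ∈ R, ¬ ((openGraph (T ∩ E)).Reachable s r ∧ (openGraph (Tᶜ ∩ E)).Reachable s r))
    (hM : ∀ r ∈ R, ¬ ((openGraph (M ∩ E)).Reachable s r ∧ (openGraph (Mᶜ ∩ E)).Reachable s r))
    (hag : ∀ u ∈ R, (∀ e ∈ ZoneSys.blk E (zone E s k₀ R T u), (e ∈ M ↔ e ∈ T)) ∨
      (∀ e ∈ ZoneSys.blk E (zone E s k₀ R T u), (e ∈ M ↔ e ∉ T)))
    {r : V} (hrR : r ∈ R) (hq : (openGraph (T ∩ E)).Reachable s r)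
    (hagr : ∀ e ∈ ZoneSys.blk E (zone E s k₀ R T r), (e ∈ M ↔ e ∈ T))
    (hk₀ : k₀ ∉ zone E s k₀ R T r) (hrM : ¬ (openGraph (M ∩ E)).Reachable s r) (hbM : ¬ (openGraph (Mᶜ ∩ E)).Reachable s r) :
    M ∉ swSet E s k₀ R := by
  have hZ := zone_of_red (k₀ := k₀) (R := R) (hT r hrR) hq
  obtain ⟨hcl, -, -⟩ := std_basic (k₀ := k₀) (R := R) (hT r hrR) (hM r hrR) hq hagr
  have hrk : r ≠ k₀ := fun h => hk₀ (h ▸ mem_zone_self)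
  have hE : s(r, k₀) ∈ E := by rw [Sym2.eq_swap]; exact huniv r hrk
  -- `r k₀` is red (blue would put `k₀` in the zone), in `T` and in `M`; hence `s k₀` is blue in `M`
  have hrkT : s(r, k₀) ∈ T := by
    by_contra h
    exact hk₀ (by rw [hZ]; exact ((openGraph_adj (Tᶜ ∩ E) r k₀).2 ⟨⟨h, hE⟩, hrk⟩).reachable)
  have hrkM : s(r, k₀) ∈ M := (hagr _ (by rw [hZ]; exact ZoneSys.mk_mem_blk hE hrk (Or.inl (mem_openCluster_self _ _)))).2 hrkT
  obtain ⟨-, -, hiffM⟩ := opp_spoke (T := M) hk huniv hrM hbM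
  have hskM : s(s, k₀) ∉ M := hiffM.1 hrkM
  obtain ⟨-, hn2⟩ := hub_not_reached (T := M) hk huniv hrM hbM
  have hk₀nr : ¬ (openGraph (M ∩ E)).Reachable s k₀ := hn2 hskM
  -- suppose `M` is swallowing, with witness `q ∈ R` reached in `M` in the red `M`-cluster `Q` of `k₀` (which contains `r`)
  rintro ⟨q, hqR, hqM, hqh⟩
  rw [hub_of_blue hskM] at hqh
  have hqnr : ¬ (openGraph (M ∩ E)).Reachable s q := not_reachable_of_mem_openCluster _ hqh hk₀nr
  have hqb : (openGraph (Mᶜ ∩ E)).Reachable s q := hqM.resolve_left hqnr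
  have hrQ : r ∈ openCluster (M ∩ E) k₀ :=
    ((openGraph_adj (M ∩ E) k₀ r).2 ⟨⟨by rw [Sym2.eq_swap]; exact hrkM, by rw [Sym2.eq_swap]; exact hE⟩, hrk.symm⟩).reachable
  have hQq : openCluster (M ∩ E) q = openCluster (M ∩ E) k₀ := openCluster_eq_of_mem _ hqh
  by_cases hqT : (openGraph (T ∩ E)).Reachable s q ∨ (openGraph (Tᶜ ∩ E)).Reachable s q
  · -- `q` standard in `T`: its zone is invariant and would contain `k₀` and `r`
    obtain ⟨hz, -⟩ := std_inv hk huniv (hT q hqR) (hM q hqR) hqT (hag q hqR)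
    have hzM := hz hqM
    rw [zone_of_blue (hM q hqR) hqb, hQq] at hzM   -- hzM : openCluster (M ∩ E) k₀ = zone T q
    rcases hqT with hqr' | hqb'
    · rw [zone_of_red (hT q hqR) hqr'] at hzM
      have hrq : r ∈ openCluster (Tᶜ ∩ E) q := by rw [← hzM]; exact hrQ
      have hk₀q : k₀ ∈ openCluster (Tᶜ ∩ E) q := by rw [← hzM]; exact mem_openCluster_self _ _
      apply hk₀
      rw [hZ, openCluster_eq_of_mem _ hrq]
      exact hk₀q
    · rw [zone_of_blue (hT q hqR) hqb'] at hzM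
      have hrq : r ∈ openCluster (T ∩ E) q := by rw [← hzM]; exact hrQ
      exact not_reachable_of_mem_openCluster _ hrq (fun h => hT q hqR ⟨h, hqb'⟩) hq
  · rw [not_or] at hqT
    by_cases hswT : T ∈ swSet E s k₀ R
    · -- `q` swallowed in `T`: reduce to its swallower `q₁`
      obtain ⟨q₁, hq₁R, hq₁T, hZ₁, hk₀Z₁⟩ := exists_swallower hk huniv hT hqT.1 hqT.2 hswT
      obtain ⟨hz₁, hreach₁⟩ := std_inv hk huniv (hT q₁ hq₁R) (hM q₁ hq₁R) hq₁T (hag q₁ hq₁R)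
      have hq₁M := hreach₁ hk₀Z₁
      have hZM₁ := hz₁ hq₁M       -- zone M q₁ = zone T q₁ = hub T ∋ k₀
      -- `q₁` is blue-reached in `M` (its `M`-zone contains the blue-reached `k₀`), so its zone is the red `M`-cluster `Q`
      have hk₀b : (openGraph (Mᶜ ∩ E)).Reachable s k₀ := (hubv_reached (T := M) hk huniv).2 hskM
      have hq₁b : (openGraph (Mᶜ ∩ E)).Reachable s q₁ := by
        rcases hq₁M with h | h
        · exfalso
          have : k₀ ∈ openCluster (Mᶜ ∩ E) q₁ := by rw [← zone_of_red (hM q₁ hq₁R) h, hZM₁]; exact hk₀Z₁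
          exact not_reachable_of_mem_openCluster _ this (fun h' => hM q₁ hq₁R ⟨h, h'⟩) hk₀b
        · exact h
      rw [zone_of_blue (hM q₁ hq₁R) hq₁b] at hZM₁   -- openCluster (M ∩ E) q₁ = zone T q₁
      have hk₀' : k₀ ∈ openCluster (M ∩ E) q₁ := by rw [hZM₁]; exact hk₀Z₁
      have hrZ₁ : r ∈ zone E s k₀ R T q₁ := by rw [← hZM₁, ← openCluster_eq_of_mem _ hk₀']; exact hrQ
      rw [hZ₁] at hrZ₁
      obtain ⟨hn1T, hn2T⟩ := hub_not_reached hk huniv hqT.1 hqT.2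
      by_cases hsT : s(s, k₀) ∈ T
      · rw [hub_of_red hsT] at hrZ₁
        apply hk₀
        rw [hZ, openCluster_eq_of_mem _ hrZ₁]
        exact mem_openCluster_self _ _
      · rw [hub_of_blue hsT] at hrZ₁
        exact not_reachable_of_mem_openCluster _ hrZ₁ (hn2T hsT) hq
    · -- `q` small in `T`: its own cluster is unreached in `T` and congruent in `M`
      have hZq := zone_of_small hqT.1 hqT.2 hswT
      have hk₀own : k₀ ∉ own E s k₀ T q := fun h => by
        obtain ⟨h1, h2⟩ := own_unreached hk huniv hqT.1 hqT.2 h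
        obtain ⟨g1, g2⟩ := hubv_reached (T := T) hk huniv
        by_cases hsT : s(s, k₀) ∈ T
        · exact h1 (g1 hsT)
        · exact h2 (g2 hsT)
      rcases hag q hqR with ha | ha
      · by_cases hsT : s(s, k₀) ∈ T
        · -- own = red cluster of q, unchanged in M: = Q ∋ k₀
          rw [own_of_red hsT] at hZq hk₀own
          have hcq : openCluster (M ∩ E) q = openCluster (T ∩ E) q := by
            refine openCluster_eq_of_agree' (T ∩ E) (M ∩ E) q fun x hx y hxy => ?_
            by_cases hxyE : s(x, y) ∈ E
            · have := ha _ (by rw [hZq]; exact ZoneSys.mk_mem_blk hxyE hxy (Or.inl hx))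
              simp only [Set.mem_inter_iff, hxyE, and_true, this]
            · simp only [Set.mem_inter_iff, hxyE, and_false]
          apply hk₀own
          rw [← hcq, hQq]
          exact mem_openCluster_self _ _
        · rw [own_of_blue hsT] at hZq
          have hcq : openCluster (Mᶜ ∩ E) q = openCluster (Tᶜ ∩ E) q := by
            refine openCluster_eq_of_agree' (Tᶜ ∩ E) (Mᶜ ∩ E) q fun x hx y hxy => ?_
            by_cases hxyE : s(x, y) ∈ E
            · have := ha _ (by rw [hZq]; exact ZoneSys.mk_mem_blk hxyE hxy (Or.inl hx))
              simp only [Set.mem_inter_iff, Set.mem_compl_iff, hxyE, and_true, this]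
            · simp only [Set.mem_inter_iff, hxyE, and_false]
          have : s ∈ openCluster (Mᶜ ∩ E) q := hqb.symm
          rw [hcq] at this
          exact hqT.2 (show (openGraph (Tᶜ ∩ E)).Reachable q s from this).symm
      · by_cases hsT : s(s, k₀) ∈ T
        · rw [own_of_red hsT] at hZq
          have hcq : openCluster (Mᶜ ∩ E) q = openCluster (T ∩ E) q := by
            refine openCluster_eq_of_agree' (T ∩ E) (Mᶜ ∩ E) q fun x hx y hxy => ?_
            by_cases hxyE : s(x, y) ∈ E
            · have := ha _ (by rw [hZq]; exact ZoneSys.mk_mem_blk hxyE hxy (Or.inl hx))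
              simp only [Set.mem_inter_iff, Set.mem_compl_iff, hxyE, and_true, this, not_not]
            · simp only [Set.mem_inter_iff, hxyE, and_false]
          have : s ∈ openCluster (Mᶜ ∩ E) q := hqb.symm
          rw [hcq] at this
          exact hqT.1 (show (openGraph (T ∩ E)).Reachable q s from this).symm
        · rw [own_of_blue hsT] at hZq hk₀own
          have hcq : openCluster (M ∩ E) q = openCluster (Tᶜ ∩ E) q := by
            refine openCluster_eq_of_agree' (Tᶜ ∩ E) (M ∩ E) q fun x hx y hxy => ?_
            by_cases hxyE : s(x, y) ∈ E
            · have := ha _ (by rw [hZq]; exact ZoneSys.mk_mem_blk hxyE hxy (Or.inl hx))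
              simp only [Set.mem_inter_iff, Set.mem_compl_iff, hxyE, and_true, this]
            · simp only [Set.mem_inter_iff, hxyE, and_false]
          apply hk₀own
          rw [← hcq, hQq]
          exact mem_openCluster_self _ _

end Invariance

end UCone

end Antithetic

end Summit.CriticalPhenomena.PercolationContinuityZ3.Theorems
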